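import Literature.AlgebraicGeometry.Motives.GoodReductionZariskiProofs
import Literature.AlgebraicGeometry.Motives.ProductProjEmbedding
import Literature.AlgebraicGeometry.Morphisms.CechH1ProjectiveCover
import Literature.AlgebraicGeometry.Morphisms.GeometricallyConnectedOfSection
import Literature.AlgebraicGeometry.Resolution.DominatingDVR
import Literature.AlgebraicGeometry.Resolution.PointBlowupProjectionRingHom
import Literature.AlgebraicGeometry.Motives.ProjectiveSpaceFunctionField
import Mathlib.AlgebraicGeometry.Morphisms.Flat
import Mathlib.AlgebraicGeometry.FunctionField
import HarnessLib

/-!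
# Zariski's connectedness with sections: connected fibres by degeneration along a DVR

Topic: `Literature/AlgebraicGeometry/Resolution`. Zariski's connectedness theorem (EGA III₁
4.3.1; The Stacks Project, Tag 03H2: a proper `f : X → S` with `f_* 𝒪_X = 𝒪_S` has
geometrically connected fibres) rests on the theorem on formal functions for ARBITRARY proper
morphisms, i.e. on the coherence theorem, which the tree does not have (the named fact
`Morphisms.steinFactorization_geometricallyConnected` records the general statement). The tree
DOES have the theorem on formal functions for FLAT PROJECTIVE schemes over a Noetherian ring and
a principal ideal (`Morphisms.hasSurjectiveFormalFunctions_of_finite_cechH1` with Serre's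
finiteness `Morphisms.ProjCech.moduleFinite_cechH1`) and Zariski's argument on the closed fibre
(`Motives.preconnectedSpace_pullback_of_hasSurjectiveFormalFunctions`). This file PROVES from
them the following form of Zariski's theorem, sufficient for de Jong 1996, 4.11–4.12 (the pencil
`f : X' → ℙ^{d-1}` has geometrically connected fibres), where the extra hypothesis — local
sections of `f` through every component of every fibre — replaces the missing generality:

* `isConnected_preimage_singleton` — **connected fibres by degeneration.** Let `f : X → S` be a
  proper morphism of `k`-schemes, `X` projective over `k`, `S` integral, with
  `Γ(V, 𝒪_S) → Γ(f⁻¹V, 𝒪_X)` bijective for every affine `V` (`f_* 𝒪_X = 𝒪_S`), and `y ∈ S` a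
  point admitting a discrete valuation ring `r : Spec R → S` through `y` and the generic point.
  If every irreducible component of `f⁻¹{y}` contains the value at `y` of a local section of
  `f`, then `f⁻¹{y}` is connected. PROOF: base change to `R`; the scheme-theoretic closure
  `X''` of the generic fibre `G = X ×_S Spec K` (`K = Frac R`; de Jong 1996, 2.18, the strict
  transform) is flat over `R` (`flat_gc`: its functions embed affine-locally into functions on
  `G`, a `K`-algebra — no torsion), projective over `R` (a closed subscheme of
  `X ×_k Spec R ⊆ 𝐏ⁿ_R`, `Motives.exists_isClosedImmersion_PP`), and `Γ(X'', 𝒪) = R`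
  (`bijective_appTop_gc`: `Γ(G, 𝒪) = K` by flat base change of `f_* 𝒪_X = 𝒪_S` along the FLAT
  point `Spec K → S` over the generic point, `isIso_appTop_snd_of_bijective_app`; a function on
  `X''` is integral over `R` and constant on `G`); so the special fibre of `X''` is connected
  (`isPreconnected_image_specialFibre`, formal functions + Zariski). Each local section of `f`
  gives a section of `X_R → Spec R` whose special value lies in that special fibre
  (`apply_closedPoint_mem_of_section`) — so the connected special fibre of `X''`, pushed into
  `f⁻¹{y}`, meets every irreducible component of `f⁻¹{y}`, which is therefore connected.
* `geometricallyConnected_of_isConnected_of_sections` — connected fibres with local sections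
  are geometrically connected (`Morphisms.geometricallyConnected_of_section`, Stacks 04KV).
* `exists_dvr_through_point_projectiveSpace` — through every point of `ℙᵈ_k` passes a discrete
  valuation ring meeting the generic point (`DominatingDVR.lean` on a standard chart).

Everything is proved; no named facts.

## Sources

* A. Grothendieck, EGA III₁, Théorème 4.3.1 (Zariski's connectedness theorem); The Stacks
  Project, Tags 03H0/03H2 (Zariski's connectedness and Stein factorisation), 02OC (formal
  functions), 02KH (flat base change), 04KV. [StacksProject]
* A. J. de Jong, *Smoothness, semi-stability and alterations*, Publ. Math. IHÉS 83 (1996)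
  51–93: 2.18 (strict transform, p. 60), 4.12 (p. 69). [DeJong1996]
-/

noncomputable section

open CategoryTheory CategoryTheory.Limits AlgebraicGeometry TopologicalSpace Opposite

universe u

namespace Literature.AlgebraicGeometry.Resolution

namespace ZariskiSections

/-! ## Flatness of a field-valued point over the generic point -/

/-- A morphism `t : Spec K → S`, `K` a field, hitting the generic point of the integral scheme
`S` is flat: its stalk map is a ring map out of the field `𝒪_{S,η} = K(S)`. [folklore] -/
theorem flat_of_apply_eq_genericPoint {S : Scheme.{u}} [IsIntegral S] {K : Type u} [Field K]
    (t : Spec (.of K) ⟶ S) (ht : ∀ x, t x = genericPoint S) : Flat t := by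
  refine Flat.of_stalkMap _ fun x => ?_
  have hfield : IsField (S.presheaf.stalk (t x)) := by
    rw [ht x]
    exact Field.toIsField S.functionField
  exact RingHom.Flat.of_isField hfield _

/-! ## Global functions on the generic fibre -/

/-- **`Γ(X ×_S Spec K, 𝒪) = K` when `f_* 𝒪_X = 𝒪_S` and `Spec K → S` is flat.** Let
`f : X → S` be quasi-compact and quasi-separated with `Γ(V, 𝒪_S) → Γ(f⁻¹V, 𝒪_X)` bijective for
every affine open `V`, and `t : Spec K → S` flat (e.g. over the generic point of an integral
`S`). Then for the base change `G = X ×_S Spec K` the structure map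
`Γ(Spec K, 𝒪) → Γ(G, 𝒪_G)` is an isomorphism (flat base change of sections, Mathlib
`isIso_pushoutSection_of_isQuasiSeparated_of_flat_right`, the pushout of an isomorphism being
an isomorphism). [cite: StacksProject, Tag 02KH] -/
theorem isIso_appTop_snd_of_bijective_app {X S G : Scheme.{u}} (f : X ⟶ S) [QuasiCompact f]
    [QuasiSeparated f] (hΓ : ∀ V : S.Opens, IsAffineOpen V → Function.Bijective (f.app V))
    {K : Type u} [Field K] (t : Spec (.of K) ⟶ S) [Flat t] {gX : G ⟶ X}
    {gK : G ⟶ Spec (.of K)} (H : IsPullback gX gK f t) : IsIso gK.appTop := by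
  -- an affine open `V` of `S` through the image point of `t`
  obtain ⟨x₀⟩ : Nonempty (Spec (CommRingCat.of K)) := inferInstance
  obtain ⟨_, ⟨V, hV, rfl⟩, hxV, -⟩ := S.isBasis_affineOpens.exists_subset_of_mem_open
    (Set.mem_univ (t x₀)) isOpen_univ
  have htV : (⊤ : (Spec (CommRingCat.of K)).Opens) ≤ t ⁻¹ᵁ V := by
    intro x _
    show t x ∈ V
    rw [Subsingleton.elim x x₀]
    exact hxV
  have hpre : gX ⁻¹ᵁ (f ⁻¹ᵁ V) = ⊤ := by
    rw [eq_top_iff]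
    intro x _
    show f (gX x) ∈ V
    rw [← Scheme.Hom.comp_apply, H.w, Scheme.Hom.comp_apply]
    exact htV trivial
  have hUY : (⊤ : G.Opens) = gX ⁻¹ᵁ (f ⁻¹ᵁ V) ⊓ gK ⁻¹ᵁ ⊤ := by
    rw [hpre, Scheme.Hom.preimage_top, inf_idem]
  have hiso := isIso_pushoutSection_of_isQuasiSeparated_of_flat_right H (US := V) (UT := ⊤)
    (UX := f ⁻¹ᵁ V) (UY := ⊤) htV le_rfl hUY hV (isAffineOpen_top _)
    (f.isCompact_preimage hV.isCompact) (f.isQuasiSeparated_preimage hV.isQuasiSeparated)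
  haveI : IsIso (f.appLE V (f ⁻¹ᵁ V) le_rfl) := by
    rw [← Scheme.Hom.app_eq_appLE]
    exact (ConcreteCategory.isIso_iff_bijective _).mpr (hΓ V hV)
  have hinr : pushout.inr _ _ ≫ pushoutSection H (US := V) (UT := ⊤) (UX := f ⁻¹ᵁ V)
      (UY := ⊤) htV le_rfl hUY = gK.appLE ⊤ ⊤ (by simp) :=
    pushout.inr_desc _ _ _
  haveI : IsIso (gK.appLE (⊤ : (Spec (CommRingCat.of K)).Opens) ⊤ (by simp)) := by
    rw [← hinr]; infer_instance
  rw [show gK.appTop = gK.appLE ⊤ ⊤ (by simp) from Scheme.Hom.app_eq_appLE gK]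
  infer_instance

/-! ## The degeneration along a discrete valuation ring -/

section Degeneration

variable {X S : Scheme.{u}} (f : X ⟶ S) {R : Type u} [CommRing R] [IsDomain R]
  (r : Spec (.of R) ⟶ S)

/-- The generic point `Spec K → Spec R`, `K = Frac R`. [folklore] -/
abbrev iK (R : Type u) [CommRing R] [IsDomain R] : Spec (.of (FractionRing R)) ⟶ Spec (.of R) :=
  Spec.map (CommRingCat.ofHom (algebraMap R (FractionRing R)))

/-- `X_R = X ×_S Spec R`. [folklore] -/
abbrev XR : Scheme.{u} := pullback f r

/-- `g_R : X_R → Spec R`. [folklore] -/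
abbrev gR : XR f r ⟶ Spec (.of R) := pullback.snd f r

/-- The generic fibre `G = X_R ×_R Spec K`. [folklore] -/
abbrev G : Scheme.{u} := pullback (gR f r) (iK R)

/-- `j : G → X_R`, an open immersion (base change of `Spec K → Spec R`). [folklore] -/
abbrev jG : G f r ⟶ XR f r := pullback.fst (gR f r) (iK R)

/-- `q : G → Spec K`. [folklore] -/
abbrev qG : G f r ⟶ Spec (.of (FractionRing R)) := pullback.snd (gR f r) (iK R)

/-- `X'' ⊆ X_R`, the scheme-theoretic closure of the generic fibre (the strict transform of `f`
along `r`, de Jong 1996, 2.18). [cite: DeJong1996, 2.18, p. 60] -/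
abbrev Xc : Scheme.{u} := (jG f r).image

/-- The closed immersion `X'' ↪ X_R`. [folklore] -/
abbrev ιc : Xc f r ⟶ XR f r := (jG f r).imageι

/-- `g'' : X'' → Spec R`. [folklore] -/
abbrev gc : Xc f r ⟶ Spec (.of R) := ιc f r ≫ gR f r

/-- `Spec K → Spec R` is an open immersion for a discrete valuation ring `R`. [folklore] -/
instance isOpenImmersion_iK [IsDiscreteValuationRing R] : IsOpenImmersion (iK R) :=
  Literature.AlgebraicGeometry.Motives.ZariskiChow.isOpenImmersion_specMap_algebraMap R
    (FractionRing R)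

/-- `G → X_R` is quasi-compact (a base change of the affine `Spec K → Spec R`). [folklore] -/
instance quasiCompact_jG : QuasiCompact (jG f r) :=
  MorphismProperty.pullback_fst _ _ inferInstance

/-- `X'' → Spec R` is proper when `f` is. [folklore] -/
instance isProper_gc [IsProper f] : IsProper (gc f r) := inferInstance

/-- `j ≫ g_R = q ≫ (Spec K → Spec R)`. [folklore] -/
theorem toImage_gc : (jG f r).toImage ≫ gc f r = qG f r ≫ iK R := by
  rw [← Category.assoc, Scheme.Hom.toImage_imageι, pullback.condition]

/-- The image of a non-zero element of `Γ(Spec R, 𝒪)` in `Γ(Spec K, 𝒪)` is a unit. [folklore] -/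
theorem isUnit_appTop_iK {a : Γ(Spec (CommRingCat.of R), ⊤)} (ha : a ≠ 0) :
    IsUnit ((iK R).appTop a) := by
  set eR := Scheme.ΓSpecIso (CommRingCat.of R) with heR
  set eK := Scheme.ΓSpecIso (CommRingCat.of (FractionRing R)) with heK
  have hnat := Scheme.ΓSpecIso_naturality (CommRingCat.ofHom (algebraMap R (FractionRing R)))
  have h1 : eK.hom ((iK R).appTop a) = algebraMap R (FractionRing R) (eR.hom a) := by
    change ((iK R).appTop ≫ eK.hom) a = _
    rw [hnat]
    rfl
  have hne : algebraMap R (FractionRing R) (eR.hom a) ≠ 0 := by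
    intro h0
    apply ha
    have : eR.hom a = 0 := (IsFractionRing.injective R (FractionRing R))
      (by rw [h0, map_zero])
    have := congrArg eR.inv this
    rwa [map_zero, ← CommRingCat.comp_apply, Iso.hom_inv_id] at this
  have hu : IsUnit (eK.hom ((iK R).appTop a)) := by rw [h1]; exact isUnit_iff_ne_zero.mpr hne
  convert hu.map eK.inv.hom using 1
  exact (eK.hom_inv_id_apply _).symm

/-- **The closure of the generic fibre is flat over `R`**: affine-locally its functions embed
(Mathlib `Scheme.Hom.toImage_app_injective`) into functions on the generic fibre, a
`K`-algebra, so they have no `R`-torsion, and torsion-free modules over a discrete valuation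
ring are flat. (De Jong 1996, 2.18: the strict transform is "given by dividing the
`𝒪_{S'}`-torsion out".) [cite: DeJong1996, 2.18, p. 60] -/
theorem flat_gc [IsDiscreteValuationRing R] : Flat (gc f r) := by
  apply HasRingHomProperty.of_iSup_eq_top (P := @Flat)
    (fun U : (XR f r).affineOpens => ⟨ιc f r ⁻¹ᵁ U, U.2.preimage _⟩)
  · apply le_antisymm le_top
    intro x _
    obtain ⟨_, ⟨U, hU, rfl⟩, hxU, -⟩ := (XR f r).isBasis_affineOpens.exists_subset_of_mem_open
      (Set.mem_univ (ιc f r x)) isOpen_univ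
    exact Opens.mem_iSup.mpr ⟨⟨U, hU⟩, hxU⟩
  intro U
  set A := Γ(Spec (CommRingCat.of R), ⊤) with hA
  set M := Γ(Xc f r, ιc f r ⁻¹ᵁ (U : (XR f r).Opens)) with hM
  set φ := ((gc f r).appLE ⊤ (ιc f r ⁻¹ᵁ (U : (XR f r).Opens)) le_top).hom with hφ
  letI : Algebra A M := φ.toAlgebra
  change Module.Flat A M
  -- `Γ(Spec R, 𝒪) ≅ R` is a principal ideal domain
  let eR : R ≃+* A := (Scheme.ΓSpecIso (.of R)).symm.commRingCatIsoToRingEquiv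
  haveI : IsDomain A := MulEquiv.isDomain R eR.symm.toMulEquiv
  haveI : IsPrincipalIdealRing A := IsPrincipalIdealRing.of_surjective eR.toRingHom eR.surjective
  rw [Module.Flat.flat_iff_torsion_eq_bot_of_isBezout, Submodule.eq_bot_iff]
  rintro m ⟨⟨a, ha⟩, ham⟩
  change a • m = 0 at ham
  have ha0 : a ≠ 0 := nonZeroDivisors.ne_zero ha
  -- restrict to the generic fibre
  let θ := ((jG f r).toImage.app (ιc f r ⁻¹ᵁ (U : (XR f r).Opens))).hom
  have hθ : Function.Injective θ := (jG f r).toImage_app_injective U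
  apply hθ
  rw [map_zero]
  have hθa : IsUnit (θ (φ a)) := by
    have e1 : θ (φ a) = ((qG f r).appLE ⊤ ((jG f r).toImage ⁻¹ᵁ (ιc f r ⁻¹ᵁ (U : (XR f r).Opens)))
        le_top).hom ((iK R).appTop a) := by
      change ((gc f r).appLE ⊤ _ le_top ≫ (jG f r).toImage.app _) a = _
      rw [Scheme.Hom.app_eq_appLE, Scheme.Hom.appLE_comp_appLE, toImage_gc,
        show (iK R).appTop = (iK R).appLE ⊤ ⊤ le_top from Scheme.Hom.app_eq_appLE _,
        ← CommRingCat.comp_apply, Scheme.Hom.appLE_comp_appLE]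
    rw [e1]
    exact (isUnit_appTop_iK (R := R) ha0).map _
  have h0 : θ (φ a) * θ m = 0 := by
    rw [← map_mul]
    change θ (a • m) = 0
    rw [ham, map_zero]
  exact (hθa.mul_right_eq_zero).mp h0


/-- The generic fibre `G` is the base change of `f` along `Spec K → Spec R → S`. [folklore] -/
theorem isPullback_G : IsPullback (jG f r ≫ pullback.fst f r) (qG f r) f (iK R ≫ r) :=
  (IsPullback.of_hasPullback (gR f r) (iK R)).paste_horiz (IsPullback.of_hasPullback f r)

/-- **Global functions on `X''` restrict injectively to the generic fibre** (the scheme-theoretic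
image of a quasi-compact morphism: Mathlib `Scheme.Hom.toImage_app_injective` on affine opens,
and the sheaf property). [folklore] -/
theorem toImage_appTop_injective : Function.Injective ((jG f r).toImage.appTop) := by
  set tI := (jG f r).toImage with htI
  intro s t hst
  rw [← sub_eq_zero] at hst ⊢
  set d := s - t with hd
  have hd0 : tI.appTop d = 0 := by rw [hd, map_sub, hst]
  -- cover `X''` by the preimages of the affine opens of `X_R`
  let V : (XR f r).affineOpens → (Xc f r).Opens := fun U => ιc f r ⁻¹ᵁ (U : (XR f r).Opens)
  have hcover : (⊤ : (Xc f r).Opens) ≤ iSup V := by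
    intro x _
    obtain ⟨_, ⟨U, hU, rfl⟩, hxU, -⟩ := (XR f r).isBasis_affineOpens.exists_subset_of_mem_open
      (Set.mem_univ (ιc f r x)) isOpen_univ
    exact Opens.mem_iSup.mpr ⟨⟨U, hU⟩, hxU⟩
  refine (Xc f r).sheaf.eq_of_locally_eq' V ⊤ (fun U => homOfLE le_top) hcover d 0 fun U => ?_
  have key : tI.app (ιc f r ⁻¹ᵁ (U : (XR f r).Opens))
      ((Xc f r).presheaf.map (homOfLE (le_top : V U ≤ ⊤)).op d) = 0 := by
    change ((Xc f r).presheaf.map (homOfLE le_top).op ≫ tI.app (ιc f r ⁻¹ᵁ (U : (XR f r).Opens))) d = 0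
    rw [Scheme.Hom.app_eq_appLE, Scheme.Hom.map_appLE,
      ← Scheme.Hom.appLE_map tI (U := ⊤) (V := ⊤) le_top (homOfLE le_top).op]
    change (G f r).presheaf.map (homOfLE le_top).op (tI.appLE ⊤ ⊤ le_top d) = 0
    rw [show tI.appLE ⊤ ⊤ le_top = tI.appTop from (Scheme.Hom.app_eq_appLE tI).symm, hd0, map_zero]
  have hinj := (jG f r).toImage_app_injective U
  have h2 : (Xc f r).presheaf.map (homOfLE (le_top : V U ≤ ⊤)).op d = 0 :=
    hinj (key.trans (map_zero _).symm)
  rw [map_zero]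
  exact h2

/-- **`Γ(X'', 𝒪) = R`** when `Γ(G, 𝒪) = K`: a global function `b` on `X''` is integral over
`R` (`X'' → Spec R` is proper), its restriction to the generic fibre is a constant `c ∈ K`,
integral over `R`, hence in `R` (integrally closed); and `b - c` vanishes on the generic
fibre, hence on `X''` (`toImage_appTop_injective`). Injectivity: `R → K = Γ(G, 𝒪)` is
injective. (Stacks 0AY8, proof.) [cite: StacksProject, Tag 0AY8] -/
theorem bijective_appTop_gc [IsDiscreteValuationRing R] [IsProper f]
    [hq : IsIso (qG f r).appTop] : Function.Bijective (gc f r).appTop := by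
  set eR := Scheme.ΓSpecIso (CommRingCat.of R) with heR
  set eK := Scheme.ΓSpecIso (CommRingCat.of (FractionRing R)) with heK
  set tI := (jG f r).toImage with htI
  have hcomp : (gc f r).appTop ≫ tI.appTop = (iK R).appTop ≫ (qG f r).appTop := by
    rw [← Scheme.Hom.comp_appTop, ← Scheme.Hom.comp_appTop, htI, toImage_gc]
  have hcomp' : ∀ a, tI.appTop ((gc f r).appTop a) = (qG f r).appTop ((iK R).appTop a) :=
    fun a => by rw [← CommRingCat.comp_apply, hcomp, CommRingCat.comp_apply]
  haveI : Nontrivial Γ(Spec (CommRingCat.of (FractionRing R)), ⊤) :=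
    eK.commRingCatIsoToRingEquiv.toEquiv.nontrivial
  have hiKinj : Function.Injective (iK R).appTop := by
    intro a b hab
    by_contra hne
    have hu := isUnit_appTop_iK (R := R) (sub_ne_zero.mpr hne)
    rw [map_sub, hab, sub_self] at hu
    exact not_isUnit_zero hu
  have hqinj : Function.Injective (qG f r).appTop :=
    (ConcreteCategory.isIso_iff_bijective _).mp hq |>.1
  refine ⟨fun a b hab => ?_, fun b => ?_⟩
  · apply hiKinj
    apply hqinj
    rw [← hcomp', ← hcomp', hab]
  · -- `b` is integral over `Γ(Spec R, 𝒪)`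
    obtain ⟨p, hp, hpb⟩ := isIntegral_appTop_of_universallyClosed (gc f r) b
    -- its restriction to `G` is a constant `c`
    set c := inv (qG f r).appTop (tI.appTop b) with hc
    have hqc : (qG f r).appTop c = tI.appTop b := by
      rw [hc, ← CommRingCat.comp_apply, IsIso.inv_hom_id, CommRingCat.id_apply]
    -- `c` is integral over `Γ(Spec R, 𝒪)` through `(iK).appTop`
    have hpc : Polynomial.eval₂ (iK R).appTop.hom c p = 0 := by
      apply hqinj
      rw [map_zero, Polynomial.hom_eval₂, hqc]
      change Polynomial.eval₂ ((iK R).appTop ≫ (qG f r).appTop).hom (tI.appTop b) p = 0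
      rw [← hcomp]
      change Polynomial.eval₂ (tI.appTop.hom.comp (gc f r).appTop.hom) (tI.appTop.hom b) p = 0
      rw [← Polynomial.hom_eval₂, hpb, map_zero]
    -- transport to `R → K`
    have hnat : eK.hom.hom.comp (iK R).appTop.hom =
        (algebraMap R (FractionRing R)).comp eR.hom.hom := by
      have := Scheme.ΓSpecIso_naturality (CommRingCat.ofHom (algebraMap R (FractionRing R)))
      rw [← heK, ← heR] at this
      exact congrArg CommRingCat.Hom.hom this
    have hint : IsIntegral R (eK.hom c) := by
      refine ⟨p.map eR.hom.hom, hp.map _, ?_⟩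
      rw [Polynomial.eval₂_map, ← hnat, ← Polynomial.hom_eval₂, hpc, map_zero]
    obtain ⟨a₀, ha₀⟩ := (IsIntegrallyClosed.isIntegral_iff (K := FractionRing R)).mp hint
    set a := eR.inv a₀ with ha
    have hac : (iK R).appTop a = c := by
      apply eK.commRingCatIsoToRingEquiv.injective
      change eK.hom ((iK R).appTop (eR.inv a₀)) = eK.hom c
      rw [← ha₀]
      change (eK.hom.hom.comp (iK R).appTop.hom) (eR.inv a₀) = _
      rw [hnat, RingHom.comp_apply]
      change algebraMap R (FractionRing R) ((eR.inv ≫ eR.hom) a₀) = _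
      rw [Iso.inv_hom_id]
      rfl
    refine ⟨a, ?_⟩
    have h0 : tI.appTop ((gc f r).appTop a - b) = 0 := by
      rw [map_sub, hcomp', hac, hqc, sub_self]
    have := toImage_appTop_injective f r (a₁ := (gc f r).appTop a - b) (a₂ := 0)
      (by rw [h0, map_zero])
    exact (sub_eq_zero.mp this)

/-- The points of `Spec R` hit by `Spec (R/𝔪) → Spec R` are the closed point only. [folklore] -/
theorem mem_range_specMap_residue_iff (R : Type u) [CommRing R] [IsLocalRing R]
    (p : Spec (CommRingCat.of R)) :
    p ∈ Set.range (Spec.map (CommRingCat.ofHom (IsLocalRing.residue R))) ↔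
      p = IsLocalRing.closedPoint R := by
  constructor
  · rintro ⟨x, rfl⟩
    apply PrimeSpectrum.ext
    have hx : x.asIdeal = ⊥ := by
      haveI : x.asIdeal.IsPrime := x.2
      exact Ideal.eq_bot_of_prime _
    change Ideal.comap (IsLocalRing.residue R) x.asIdeal = IsLocalRing.maximalIdeal R
    rw [hx, ← RingHom.ker_eq_comap_bot, IsLocalRing.ker_residue]
  · intro hp
    subst hp
    refine ⟨(⊥ : PrimeSpectrum (IsLocalRing.ResidueField R)), ?_⟩
    apply PrimeSpectrum.ext
    change Ideal.comap (IsLocalRing.residue R) ⊥ = IsLocalRing.maximalIdeal R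
    rw [← RingHom.ker_eq_comap_bot, IsLocalRing.ker_residue]

open Literature.AlgebraicGeometry.Morphisms Literature.AlgebraicGeometry.Morphisms.ProjCech in
/-- **The special fibre of `X'' → Spec R` is connected, i.e. its image in `X_R` is a
preconnected set**, when `X` is projective over a field `k` (so that `X''` is a closed subscheme
of some `𝐏ⁿ_{Γ(Spec R, 𝒪)}`) and `Γ(G, 𝒪) = K`: `X'' → Spec R` is flat (`flat_gc`) and proper with
`Γ(X'', 𝒪) = R` (`bijective_appTop_gc`), Serre's finiteness of `Ȟ¹` of the projective `X''`
(`ProjCech.moduleFinite_cechH1`) gives the theorem on formal functions for `H⁰`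
(`hasSurjectiveFormalFunctions_of_finite_cechH1`), and Zariski's argument
(`Motives.preconnectedSpace_pullback_of_hasSurjectiveFormalFunctions`) makes the closed fibre
preconnected. (Stacks 03H0, proof, run on `X''`.) [cite: StacksProject, Tag 03H0 (proof)] -/
theorem isPreconnected_image_specialFibre [IsDiscreteValuationRing R] {k : Type u} [Field k]
    (pS : S ⟶ Spec (.of k)) [IsSeparated pS] [IsProper f]
    (hproj : Literature.AlgebraicGeometry.Motives.IsProjectiveOver (Over.mk (f ≫ pS)))
    [IsIso (qG f r).appTop] :
    _root_.IsPreconnected ((ιc f r) '' {x : Xc f r | gc f r x = IsLocalRing.closedPoint R}) := by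
  classical
  haveI : Flat (gc f r) := flat_gc f r
  -- the base ring `B = Γ(Spec R, 𝒪) ≅ R`
  set B := Γ(Spec (CommRingCat.of R), ⊤) with hB
  let eR : R ≃+* B := (Scheme.ΓSpecIso (.of R)).symm.commRingCatIsoToRingEquiv
  haveI : IsDomain B := MulEquiv.isDomain R eR.symm.toMulEquiv
  haveI : IsNoetherianRing B := isNoetherianRing_of_ringEquiv R eR
  -- uniformizer and residue map, transported to `B`
  obtain ⟨ϖ, hϖ⟩ := IsDiscreteValuationRing.exists_irreducible R
  set π : B := eR ϖ with hπ
  have hπ0 : π ≠ 0 := fun h => hϖ.ne_zero (eR.injective (by rw [map_zero]; exact h))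
  have hπnzd : π ∈ nonZeroDivisors B := mem_nonZeroDivisors_of_ne_zero hπ0
  let q : B →+* IsLocalRing.ResidueField R :=
    (IsLocalRing.residue R).comp (Scheme.ΓSpecIso (.of R)).hom.hom
  have hq : Function.Surjective q :=
    IsLocalRing.residue_surjective.comp eR.symm.surjective
  have hker : RingHom.ker q = Ideal.span {π} := by
    ext b
    rw [RingHom.mem_ker, RingHom.comp_apply, ← RingHom.mem_ker, IsLocalRing.ker_residue,
      hϖ.maximalIdeal_eq, Ideal.mem_span_singleton, Ideal.mem_span_singleton, hπ]
    constructor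
    · rintro ⟨c, hc⟩
      refine ⟨eR c, ?_⟩
      apply eR.symm.injective
      rw [map_mul, eR.symm_apply_apply, eR.symm_apply_apply, ← hc]
      rfl
    · rintro ⟨c, hc⟩
      refine ⟨eR.symm c, ?_⟩
      have := congrArg eR.symm hc
      rw [map_mul, eR.symm_apply_apply] at this
      exact this
  -- the projective embedding `X'' ↪ X_R ↪ X ×_k Spec R ↪ 𝐏ⁿ_B`
  obtain ⟨n, ιX, hιX⟩ := hproj
  let P : Literature.AlgebraicGeometry.Motives.SchemeOver k := Over.mk (f ≫ pS)
  let SR : Literature.AlgebraicGeometry.Motives.SchemeOver k := Over.mk (r ≫ pS)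
  haveI : IsAffine SR.left := inferInstanceAs (IsAffine (Spec (CommRingCat.of R)))
  let ι₀ : P.left ⟶ PP k n := ιX.left
  haveI : IsClosedImmersion ι₀ := hιX
  have hι₀ : ι₀ ≫ toSpec k n = P.hom := Over.w ιX
  obtain ⟨ιP, hιPci, hιP⟩ :=
    Literature.AlgebraicGeometry.Motives.exists_isClosedImmersion_PP P SR ι₀ hι₀
  haveI := hιPci
  let e₁ : XR f r ⟶ (MonoidalCategoryStruct.tensorObj P SR).left := pullback.mapDesc f r pS
  haveI : IsClosedImmersion e₁ := inferInstanceAs (IsClosedImmersion (pullback.mapDesc f r pS))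
  have he₁ : e₁ ≫ (CartesianMonoidalCategory.snd P SR).left = gR f r := by
    change pullback.mapDesc f r pS ≫ pullback.snd (f ≫ pS) (r ≫ pS) = pullback.snd f r
    rw [pullback.lift_snd, Category.comp_id]
  have hιP' : ιP ≫ toSpec B n =
      (CartesianMonoidalCategory.snd P SR).left ≫ (Spec (CommRingCat.of R)).toSpecΓ := hιP
  let ιPP : Xc f r ⟶ PP B n := ιc f r ≫ e₁ ≫ ιP
  haveI : IsClosedImmersion ιPP := inferInstanceAs (IsClosedImmersion (ιc f r ≫ e₁ ≫ ιP))
  set gB : Xc f r ⟶ Spec (CommRingCat.of B) := gc f r ≫ (Spec (CommRingCat.of R)).toSpecΓ with hgB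
  have hstr : strZ ιPP = gB := by
    change (ιc f r ≫ e₁ ≫ ιP) ≫ toSpec B n = gc f r ≫ (Spec (CommRingCat.of R)).toSpecΓ
    rw [Category.assoc, Category.assoc, hιP', ← Category.assoc e₁, he₁]
    exact (Category.assoc _ _ _).symm
  haveI : Flat (strZ ιPP) := by rw [hstr, hgB]; infer_instance
  haveI : IsProper gB := by rw [hgB]; infer_instance
  -- Serre finiteness and the theorem on formal functions for `X'' → Spec B`
  have hfin := moduleFinite_cechH1 ιPP
  have hFF0 := hasSurjectiveFormalFunctions_of_finite_cechH1 (f := strZ ιPP) hπnzd (cover ιPP)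
    (isAffineOpen_cover ιPP) (iSup_cover_eq_top ιPP) hfin
  have hFF : HasSurjectiveFormalFunctions (RingHom.ker q) gB := by
    rw [hker, ← hstr]; exact hFF0
  -- `B → Γ(X'', 𝒪)` is bijective
  have hΓ : Function.Bijective (algebraMapΓ gB) := by
    have e : algebraMapΓ gB = ((gc f r).appTop).hom := by
      change (gB.appTop).hom.comp (Scheme.ΓSpecIso (CommRingCat.of B)).inv.hom = _
      rw [hgB, Scheme.Hom.comp_appTop, Scheme.toSpecΓ_appTop]
      ext b
      change (gc f r).appTop (((Scheme.ΓSpecIso Γ(Spec (CommRingCat.of R), ⊤)).inv ≫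
        (Scheme.ΓSpecIso Γ(Spec (CommRingCat.of R), ⊤)).hom) b) = (gc f r).appTop b
      rw [Iso.inv_hom_id]
      rfl
    rw [e]
    exact bijective_appTop_gc f r
  -- Zariski: the closed fibre of `X'' → Spec B` is preconnected
  haveI hpre := Literature.AlgebraicGeometry.Motives.preconnectedSpace_pullback_of_hasSurjectiveFormalFunctions
    gB q hFF hq hΓ
  -- identify its image in `X''` with `g''⁻¹(closed point)`
  have hq' : CommRingCat.ofHom q = (Scheme.ΓSpecIso (CommRingCat.of R)).hom ≫
      CommRingCat.ofHom (IsLocalRing.residue R) := rfl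
  have hrange : Set.range (pullback.fst gB (Spec.map (CommRingCat.ofHom q))) =
      {x : Xc f r | gc f r x = IsLocalRing.closedPoint R} := by
    rw [Scheme.Pullback.range_fst, hq', Spec.map_comp, SpecMap_ΓSpecIso_hom, hgB]
    ext x
    simp only [Set.mem_preimage, Set.mem_setOf_eq, Scheme.Hom.comp_base, TopCat.coe_comp,
      Set.range_comp, Function.comp_apply]
    rw [(Spec (CommRingCat.of R)).toSpecΓ.isOpenEmbedding.injective.mem_set_image,
      mem_range_specMap_residue_iff]
  have h1 : _root_.IsPreconnected (Set.range (pullback.fst gB (Spec.map (CommRingCat.ofHom q)))) :=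
    isPreconnected_range (pullback.fst gB (Spec.map (CommRingCat.ofHom q))).continuous
  rw [hrange] at h1
  exact h1.image _ (ιc f r).continuous.continuousOn


/-- The underlying set of `X''` is the closure of the generic fibre. [folklore] -/
theorem range_ιc : Set.range (ιc f r) = closure (Set.range (jG f r)) := by
  have h := Scheme.IdealSheafData.range_subschemeι (jG f r).ker
  rw [Scheme.Hom.support_ker] at h
  exact h

/-- **A section of `X_R → Spec R` meets the special fibre of `X''`**: its generic value lies in
the generic fibre, so its special value lies in the closure `X''` of the generic fibre, over the
closed point. [folklore] -/
theorem apply_closedPoint_mem_of_section [IsDiscreteValuationRing R] (τ : Spec (.of R) ⟶ XR f r)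
    (hτ : τ ≫ gR f r = 𝟙 _) :
    τ (IsLocalRing.closedPoint R) ∈
      (ιc f r) '' {x : Xc f r | gc f r x = IsLocalRing.closedPoint R} := by
  -- the generic value of `τ` lies in the generic fibre
  have hsec : ∀ x, gR f r (τ x) = x := fun x => by
    rw [← Scheme.Hom.comp_apply, hτ]
    rfl
  have hgen : τ (⊥ : PrimeSpectrum R) ∈ Set.range (jG f r) := by
    rw [Scheme.Pullback.range_fst]
    show gR f r (τ (⊥ : PrimeSpectrum R)) ∈ Set.range (iK R)
    rw [hsec]
    refine ⟨(⊥ : PrimeSpectrum (FractionRing R)), ?_⟩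
    apply PrimeSpectrum.ext
    change Ideal.comap (algebraMap R (FractionRing R)) ⊥ = ⊥
    rw [← RingHom.ker_eq_comap_bot]
    exact (RingHom.injective_iff_ker_eq_bot _).mp (IsFractionRing.injective R (FractionRing R))
  -- hence its special value lies in `X''`
  have hcl : τ (IsLocalRing.closedPoint R) ∈ Set.range (ιc f r) := by
    rw [range_ιc]
    have hsp : τ (⊥ : PrimeSpectrum R) ⤳ τ (IsLocalRing.closedPoint R) :=
      (IsLocalRing.specializes_closedPoint _).map τ.continuous
    exact closure_mono (Set.singleton_subset_iff.mpr hgen) (specializes_iff_mem_closure.mp hsp)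
  obtain ⟨x, hx⟩ := hcl
  refine ⟨x, ?_, hx⟩
  show gR f r (ιc f r x) = IsLocalRing.closedPoint R
  rw [hx, hsec]

/-- **Connected fibres by degeneration.** Let `f : X → S` be proper over a field `k` with `X`
projective over `k`, `S` integral, `Γ(V, 𝒪_S) = Γ(f⁻¹V, 𝒪_X)` for all affine `V`
(`f_* 𝒪_X = 𝒪_S`), and let `y ∈ S` admit a discrete valuation ring `Spec R → S` through `y` and
the generic point. If every irreducible component of the fibre `f⁻¹{y}` contains the value at
`y` of a local section of `f`, then `f⁻¹{y}` is connected: the special fibre of the flat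
closure `X''` of the generic fibre over `R` is connected (`isPreconnected_image_specialFibre`,
Zariski) and meets every component of `f⁻¹{y}` (`apply_closedPoint_mem_of_section`).
[cite: StacksProject, Tag 03H0 (proof)] -/
theorem isConnected_preimage_singleton {k : Type u} [Field k] (pS : S ⟶ Spec (.of k))
    [IsSeparated pS] [IsProper f] [IsIntegral S]
    (hproj : Literature.AlgebraicGeometry.Motives.IsProjectiveOver (Over.mk (f ≫ pS)))
    (hΓ : ∀ V : S.Opens, IsAffineOpen V → Function.Bijective (f.app V)) (y : S)
    (hne : (f ⁻¹' {y}).Nonempty)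
    (hR : ∃ (R : Type u) (_ : CommRing R) (_ : IsDomain R) (_ : IsDiscreteValuationRing R)
      (r : Spec (.of R) ⟶ S), r (IsLocalRing.closedPoint R) = y ∧
        ∀ x, (iK R ≫ r) x = genericPoint S)
    (hsec : ∀ C ∈ irreducibleComponents ↥(f ⁻¹' {y}),
      ∃ (V : S.Opens) (hy : y ∈ V) (σ : (V : Scheme.{u}) ⟶ X),
        σ ≫ f = V.ι ∧ σ ⟨y, hy⟩ ∈ Subtype.val '' C) :
    _root_.IsConnected (f ⁻¹' {y}) := by
  obtain ⟨R, _, _, _, r, hry, hgen⟩ := hR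
  haveI : Flat (iK R ≫ r) := flat_of_apply_eq_genericPoint _ hgen
  haveI : IsIso (qG f r).appTop :=
    isIso_appTop_snd_of_bijective_app f hΓ (iK R ≫ r) (isPullback_G f r)
  -- the connected set `T`
  set Xs := (ιc f r) '' {x : Xc f r | gc f r x = IsLocalRing.closedPoint R} with hXs
  have hP : _root_.IsPreconnected Xs := isPreconnected_image_specialFibre f r pS hproj
  set T := (pullback.fst f r) '' Xs with hT
  have hTP : _root_.IsPreconnected T := hP.image _ (pullback.fst f r).continuous.continuousOn
  have hTF : T ⊆ f ⁻¹' {y} := by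
    rintro _ ⟨_, ⟨x, hx, rfl⟩, rfl⟩
    show f (pullback.fst f r (ιc f r x)) ∈ ({y} : Set S)
    rw [← Scheme.Hom.comp_apply, pullback.condition, Scheme.Hom.comp_apply]
    change r (gc f r x) = y
    rw [show gc f r x = IsLocalRing.closedPoint R from hx, hry]
  -- every component meets `T`
  have hmeet : ∀ C ∈ irreducibleComponents ↥(f ⁻¹' {y}), (Subtype.val '' C ∩ T).Nonempty := by
    intro C hC
    obtain ⟨V, hyV, σ, hσ, hσy⟩ := hsec C hC
    have hrV : Set.range r ⊆ Set.range V.ι := by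
      rw [Scheme.Opens.range_ι]
      rintro _ ⟨x, rfl⟩
      have htop : r ⁻¹ᵁ V = ⊤ := (IsLocalRing.closedPoint_mem_iff _).mp (by
        show r (IsLocalRing.closedPoint R) ∈ V
        rw [hry]; exact hyV)
      have : x ∈ r ⁻¹ᵁ V := by rw [htop]; trivial
      exact this
    let rV := IsOpenImmersion.lift V.ι r hrV
    have hrV' : rV ≫ V.ι = r := IsOpenImmersion.lift_fac _ _ _
    let τ : Spec (.of R) ⟶ XR f r := pullback.lift (rV ≫ σ) (𝟙 _)
      (by rw [Category.assoc, hσ, hrV', Category.id_comp])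
    have hτ : τ ≫ gR f r = 𝟙 _ := pullback.lift_snd _ _ _
    have hmem := apply_closedPoint_mem_of_section f r τ hτ
    refine ⟨σ ⟨y, hyV⟩, hσy, τ (IsLocalRing.closedPoint R), hmem, ?_⟩
    rw [← Scheme.Hom.comp_apply, pullback.lift_fst, Scheme.Hom.comp_apply]
    congr 1
    apply Subtype.ext
    change (rV ≫ V.ι) (IsLocalRing.closedPoint R) = y
    rw [hrV', hry]
  -- conclude: `f⁻¹{y}` is the union of the `C ∪ T`
  obtain ⟨x₀, hx₀⟩ := hne
  obtain ⟨t₀, -, ht₀⟩ := hmeet _ (irreducibleComponent_mem_irreducibleComponents (⟨x₀, hx₀⟩ : ↥(f ⁻¹' {y})))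
  refine ⟨⟨x₀, hx₀⟩, ?_⟩
  have hcover : f ⁻¹' {y} = ⋃₀ ((fun C => Subtype.val '' C ∪ T) '' irreducibleComponents ↥(f ⁻¹' {y})) := by
    apply Set.Subset.antisymm
    · intro x hx
      refine Set.mem_sUnion.mpr ⟨_, ⟨irreducibleComponent (⟨x, hx⟩ : ↥(f ⁻¹' {y})),
        irreducibleComponent_mem_irreducibleComponents _, rfl⟩, ?_⟩
      exact Or.inl ⟨⟨x, hx⟩, mem_irreducibleComponent, rfl⟩
    · intro x hx
      obtain ⟨_, ⟨C, -, rfl⟩, hxC⟩ := Set.mem_sUnion.mp hx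
      rcases hxC with ⟨z, -, rfl⟩ | hxT
      · exact z.2
      · exact hTF hxT
  rw [hcover]
  apply isPreconnected_sUnion t₀
  · rintro _ ⟨C, -, rfl⟩
    exact Or.inr ht₀
  · rintro _ ⟨C, hC, rfl⟩
    obtain ⟨z, hzC, hzT⟩ := hmeet C hC
    refine IsPreconnected.union z hzC hzT ?_ hTP
    exact (IsIrreducible.image hC.1 _ continuous_subtype_val.continuousOn).2.isPreconnected

end Degeneration

/-! ## From connected fibres with sections to geometric connectedness -/

/-- **Connected fibres with local sections are geometrically connected** (Stacks 04KV applied to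
the fibres, `Morphisms.geometricallyConnected_of_section`): if `f : X → S` is universally
closed and quasi-separated, every fibre `f⁻¹{y}` is connected and through every `y` there is a
local section of `f`, then `f` is geometrically connected in Mathlib's sense (all base changes
to fields are connected). [cite: StacksProject, Tag 04KV] -/
theorem geometricallyConnected_of_isConnected_of_sections {X S : Scheme.{u}} (f : X ⟶ S)
    [UniversallyClosed f] [QuasiSeparated f] (hconn : ∀ y, _root_.IsConnected (f ⁻¹' {y}))
    (hsec : ∀ y, ∃ (V : S.Opens) (_ : y ∈ V) (σ : (V : Scheme.{u}) ⟶ X), σ ≫ f = V.ι) :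
    GeometricallyConnected f := by
  rw [GeometricallyConnected.iff_geometricallyConnected_fiber]
  intro y
  have hUC : UniversallyClosed (f.fiberToSpecResidueField y) :=
    MorphismProperty.pullback_snd (P := @UniversallyClosed) _ _ inferInstance
  haveI : QuasiSeparated (f.fiberToSpecResidueField y) :=
    MorphismProperty.pullback_snd (P := @QuasiSeparated) _ _ inferInstance
  have hQS : QuasiSeparatedSpace (f.fiber y) :=
    quasiSeparatedSpace_of_quasiSeparated (f.fiberToSpecResidueField y)
  have hCS : ConnectedSpace (f.fiber y) :=
    (f.fiberHomeo y).connectedSpace_iff.mpr (Subtype.connectedSpace (hconn y))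
  obtain ⟨V, hyV, σ, hσ⟩ := hsec y
  have hrange : Set.range (S.fromSpecResidueField y) ⊆ Set.range V.ι := by
    rw [Scheme.range_fromSpecResidueField, Scheme.Opens.range_ι, Set.singleton_subset_iff]
    exact hyV
  let ry := IsOpenImmersion.lift V.ι (S.fromSpecResidueField y) hrange
  have hry : ry ≫ V.ι = S.fromSpecResidueField y := IsOpenImmersion.lift_fac _ _ _
  let s : Spec (S.residueField y) ⟶ f.fiber y :=
    pullback.lift (ry ≫ σ) (𝟙 _) (by rw [Category.assoc, hσ, hry, Category.id_comp])
  have hs : s ≫ f.fiberToSpecResidueField y = 𝟙 _ := pullback.lift_snd _ _ _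
  exact @Literature.AlgebraicGeometry.Morphisms.geometricallyConnected_of_section
    (S.residueField y) _ (f.fiber y) (f.fiberToSpecResidueField y) hUC hQS hCS s hs


/-! ## Discrete valuation rings through the points of projective space -/

section ProjectiveSpace

open Literature.AlgebraicGeometry.Motives Literature.AlgebraicGeometry.Motives.Segre

attribute [local instance] MvPolynomial.gradedAlgebra

/-- The generic point `Spec K → Spec R` hits `(0) ∈ Spec R`. [folklore] -/
theorem iK_apply {R : Type u} [CommRing R] [IsDomain R] (x : Spec (.of (FractionRing R))) :
    iK R x = (⊥ : PrimeSpectrum R) := by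
  apply PrimeSpectrum.ext
  have hx : x.asIdeal = ⊥ := by
    haveI : x.asIdeal.IsPrime := x.2
    exact Ideal.eq_bot_of_prime _
  change Ideal.comap (algebraMap R (FractionRing R)) x.asIdeal = ⊥
  rw [hx, ← RingHom.ker_eq_comap_bot]
  exact (RingHom.injective_iff_ker_eq_bot _).mp (IsFractionRing.injective R (FractionRing R))

/-- **Through every point of `ℙᵈ_k` passes a discrete valuation ring meeting the generic
point**: the point lies in a standard chart `D₊(xᵢ) ≅ 𝔸ᵈ_k`, through whose points pass the
discrete valuation rings of `DominatingDVR.lean` (`exists_dvr_through`). Here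
`ℙᵈ_k = ProjSpace.P d k = (projectiveSpace d k).left`. [folklore] -/
theorem exists_dvr_through_point_projectiveSpace {k : Type u} [Field k] (d : ℕ)
    (y : ProjSpace.P d k) :
    ∃ (R : Type u) (_ : CommRing R) (_ : IsDomain R) (_ : IsDiscreteValuationRing R)
      (r : Spec (.of R) ⟶ ProjSpace.P d k),
      r (IsLocalRing.closedPoint R) = y ∧
        ∀ x, (iK R ≫ r) x = genericPoint (ProjSpace.P d k) := by
  -- a standard chart through `y`
  have htop := Proj.iSup_basicOpen_eq_top (grading (Fin (d + 1)) k)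
    (MvPolynomial.X : Fin (d + 1) → MvPolynomial (Fin (d + 1)) k)
    (ProjectiveSpace.irrelevant_le_span d k)
  have hy : y ∈ (⨆ i, Proj.basicOpen (grading (Fin (d + 1)) k)
      (MvPolynomial.X i : MvPolynomial (Fin (d + 1)) k)) := by
    rw [htop]; trivial
  obtain ⟨i, hi⟩ := TopologicalSpace.Opens.mem_iSup.mp hy
  have hrange : y ∈ Set.range (chartι k i) := by
    rw [← Scheme.Hom.coe_opensRange, Proj.opensRange_awayι]
    exact hi
  obtain ⟨y₀, hy₀⟩ := hrange
  -- the chart ring is a polynomial ring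
  set A := HomogeneousLocalization.Away (grading (Fin (d + 1)) k)
    (MvPolynomial.X i : MvPolynomial (Fin (d + 1)) k) with hA
  let e : A ≃+* PointBlowup.Base d k i := PointBlowup.awayBaseEquiv d k i
  haveI : IsDomain A := MulEquiv.isDomain (PointBlowup.Base d k i) e.toMulEquiv
  -- the DVR through the point `y₀` of `Spec A`
  let 𝔮 : Ideal (PointBlowup.Base d k i) := Ideal.comap e.symm.toRingHom y₀.asIdeal
  haveI : 𝔮.IsPrime := Ideal.comap_isPrime _ _
  obtain ⟨R, _, _, _, φ, hφ, hcomap⟩ := exists_dvr_through 𝔮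
  let ψ : A →+* R := φ.comp e.toRingHom
  have hψ : Function.Injective ψ := hφ.comp e.injective
  have hψcomap : Ideal.comap ψ (IsLocalRing.maximalIdeal R) = y₀.asIdeal := by
    change Ideal.comap (φ.comp e.toRingHom) _ = _
    rw [← Ideal.comap_comap, hcomap, Ideal.comap_comap, RingEquiv.symm_toRingHom_comp_toRingHom,
      Ideal.comap_id]
  refine ⟨R, inferInstance, inferInstance, inferInstance,
    Spec.map (CommRingCat.ofHom ψ) ≫ chartι k i, ?_, fun x => ?_⟩
  · rw [Scheme.Hom.comp_apply, ← hy₀]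
    congr 1
    apply PrimeSpectrum.ext
    exact hψcomap
  · rw [Scheme.Hom.comp_apply, Scheme.Hom.comp_apply, iK_apply]
    have hgen : (Spec.map (CommRingCat.ofHom ψ)) (⊥ : PrimeSpectrum R) =
        genericPoint (Spec (CommRingCat.of A)) := by
      rw [genericPoint_eq_bot_of_affine]
      apply PrimeSpectrum.ext
      change Ideal.comap ψ ⊥ = ⊥
      rw [← RingHom.ker_eq_comap_bot]
      exact (RingHom.injective_iff_ker_eq_bot _).mp hψ
    rw [hgen]
    exact genericPoint_eq_of_isOpenImmersion (chartι k i)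

end ProjectiveSpace

end ZariskiSections

end Literature.AlgebraicGeometry.Resolution

end
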